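import Literature.AlgebraicGeometry.ComplexMultiplication.CMTorusHodgeClassesPohlmann
import Literature.NumberTheory.ComplexMultiplication.CMTypeInducedFromPrimitive
import Literature.Geometry.Kaehler.ComplexTorusHodgeClassesMaximalPicardNumber
import HarnessLib

/-!
# The Picard number of a CM torus of INDUCED type: `ρ(ℂ^Φ/u(𝔪)) = [K:K₁]² · ρ(ℂ^{Φ₁}/u(𝔪₁)) = [K:K₁] · dim X`
# for `Φ = Φ₁^K` induced from a primitive pair `(K₁; Φ₁)` (Murty 1984, Lemma 3.3, type IV with `d = 1`)

Family `hodge`, lane `lit-hodgefound` (Track 2; Layer A4 row A4-13 «Picard number», Layer A3 «CM abelian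
varieties»), topic `Literature/AlgebraicGeometry/ComplexMultiplication`, namespaces
`Literature.AlgebraicGeometry.Pohlmann1968` (§§1–2, the combinatorics of balanced pairs) and
`Literature.AlgebraicGeometry.ComplexMultiplication.CMTorus` (§3, the CM tori).  Sequel of
`CMTorusHodgeClassesPohlmann` (Pohlmann's count `ρ(ℂ^Φ/u(𝔪)) = #(pohlmannSets Φ 1)` and, § `PicardNumber`, the
PRIMITIVE case `ρ = dim X` of a simple CM torus).  THEOREMS ONLY (no definition, no named fact; D-0026 net
debt `0`).

THE PRINT.  V. Kumar Murty, *Exceptional Hodge classes on certain abelian varieties*, Math. Ann. **268** (1984)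
197–206 [Murty1984], Lemma 3.3, as restated VERBATIM by K. Hulek, R. Laface, *On the Picard numbers of abelian
varieties*, Ann. Sc. Norm. Super. Pisa (5) 19 (2019) [HulekLaface2019PicardNumbers] (held `paper:arxiv-1703.05882`, p0006
L9–L20): «**Proposition 2.4** (Lemma 3.3 of [murty84]). Let `A` be a simple abelian variety. Set `e := [K : ℚ]`,
`d² := [F : K]`. Then, for `k ≥ 1`, one has `ρ(A^k) = ½ e k(k+1)` (Type I), `e k(2k+1)` (Type II), `e k(2k−1)`
(Type III), **`½ e d² k²` (Type IV)**», with its reformulation p0006 L44–L48 «`ρ(A^k) = ρ k²` (Type IV)» (proof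
of Cor. 2.5) and p0006 L77–L85 «**Corollary 2.6.** If `E` is an elliptic curve, then `ρ(E^k) = ½ k(k+1)` (`E` has
no CM), **`k²` (`E` has CM)**».  Here `F = End_ℚ(A)` with centre `K`, of the second kind (type IV) when `K` is a
CM field [HulekLaface2019PicardNumbers, §2.2, p0005 L73–p0006 L7].

THE CASE FORMALISED.  `A = B` a SIMPLE CM abelian variety / torus of a PRIMITIVE type `(K₁; Φ₁)`:
`End_ℚ(B) = K₁` is the CM field itself (Shimura 1998 §5.1 Prop. 6 «`g = 1` and `End_ℚ(B) = K`»; tree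
`CMAbelianVarietyEndomorphismAlgebraInducedType`), so `F = K = K₁`, `d = 1`, `e = [K₁ : ℚ] = 2 dim B`, and
Murty's formula reads **`ρ(B^k) = ½ e k² = k² · dim B`**.  By Shimura 1998 §6.2 THEOREM 3 (p. 42: for the type
`(K; {φᵢ})` induced from `(K₁; {ψⱼ})`, `[K : K₁] = h`, «`ℂⁿ/D(𝔪)` is complex analytically isomorphic to the direct
product of `h` copies of `ℂ^m/Δ`»; tree `CMTypeLattice.isIsogenous_periodIso_powPeriod`) the CM tori
`X = ℂ^Φ/u(𝔪)` of an INDUCED type `Φ = Φ₁^K` are (isogenous to) the powers `B^h` of the simple torus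
`B = ℂ^{Φ₁}/u(𝔪₁)`, `h = [K : K₁]`, `dim X = h · dim B`; and `Φ₁` primitive ⟺ `B` simple (§8.2 Prop. 26, tree
`CMTypeLattice.isSimple_periodEquiv_iff`).  So the print says: **`ρ(X) = h² · dim B = h · dim X = h² · ρ(B)`**.

THE PROOF FORMALISED (Pohlmann's count, not the Albert classification).  By Pohlmann 1968 Thm. 1 with `p = 1`
and Lefschetz `(1,1)` for tori (tree `CMTorus.finrank_neronSeveriGroup_eq_ncard_pohlmannSets`), `ρ(ℂ^Φ/u(𝔪))` is
the number of BALANCED PAIRS `Δ = {φ, ψ} ⊆ Hom(K, ℂ)` of `Φ` (`|τΔ ∩ Φ| = |τΔ ∩ Φ̄| = 1` for every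
`τ ∈ Aut(ℂ)`).  For the induced type `Φ = Φ₁^K = {φ | φ|_{K₁} ∈ Φ₁}` the condition only sees the restrictions
`φ|_{K₁}`, `ψ|_{K₁}`, and (§1) **every pair `{φ, ψ}` with `ψ|_{K₁} = (φ|_{K₁})‾` is balanced** (for each `τ`
exactly one of `τφ|_{K₁}`, `τψ|_{K₁} = (τφ|_{K₁})‾` lies in `Φ₁`) — for EVERY inducing pair, no primitivity —
while **for `Φ₁` PRIMITIVE these are all the balanced pairs** (a balanced `{φ, ψ}` has `τψ|_{K₁} ∈ Φ₁ ⟺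
τ(φ|_{K₁})‾ ∈ Φ₁` for all `τ`, so `ψ|_{K₁} = (φ|_{K₁})‾` because the translates of a primitive `Φ₁` separate the
embeddings of `K₁`, Shimura §8.2 Prop. 26 in the `Aut(ℂ)`-form used throughout the lane; the case `h = 1` is the
tree's `Pohlmann1968.mem_pohlmannSets_one_iff_of_primitive`).  Counting (§2): a balanced pair has exactly one
member in `Φ` (`τ = 1`), and for `φ ∈ Φ` the admissible `ψ` are the `[K : K₁]` extensions of `(φ|_{K₁})‾` to `K`
(`#Hom_{K₁}(K, ℂ) = [K : K₁]`, Mathlib `AlgHom.card`), so there are `#Φ · [K : K₁] = dim X · h` of them.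

WHAT IS PROVED.  §1 (`Pohlmann1968`; `j : K₁ →+* K` any ring map from a CM field `K₁` into a field `K`,
`Φ₁ : CMType K₁`):
* `pair_mem_pohlmannSets_one_inducedCMType` — `ψ ∘ j = (φ ∘ j)‾ ⟹ {φ, ψ} ∈ pohlmannSets (Φ₁^K) 1`;
* `mem_pohlmannSets_one_inducedCMType_iff` — the balanced pairs of `Φ₁^K` are the `{φ, ψ}`, `φ ≠ ψ`, whose
  restrictions `ψ|_{K₁}` and `(φ|_{K₁})‾` are not separated by the translates of `Φ₁`;
* `mem_pohlmannSets_one_inducedCMType_iff_of_primitive` (+ `…_iff_mem_and_comp_eq…`, normalised with `φ ∈ Φ₁^K`)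
  — for `Φ₁` PRIMITIVE: balanced ⟺ `Δ = {φ, ψ}` with `ψ|_{K₁} = (φ|_{K₁})‾`.
§2 (`K ⊇ K₁` number fields, `[Algebra K₁ K]`): `card_filter_comp_algebraMap_eq_finrank` (every embedding of `K₁`
has `[K : K₁]` extensions), **`ncard_pohlmannSets_one_inducedCMType_eq`** (`#balanced pairs of Φ₁^K =
[K : K₁] · [K : ℚ]/2` for `Φ₁` primitive), `mul_div_two_le_ncard_pohlmannSets_one_inducedCMType` (`≥`, any `Φ₁`).
§3 (`CMTorus`, `X = ℂ^Φ/u(𝔪) = ComplexTorus (periodEquiv Φ μ)`, `Φ = Φ₁^K`):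
* **`finrank_neronSeveriGroup_eq_of_inducedCMType`** — MURTY'S LEMMA 3.3 (IV, `d = 1`) / Shimura THM 3:
  `ρ(X) = [K : K₁] · dim X` for `Φ₁` primitive (`dim X = [K : ℚ]/2`); `…_eq_mul_sq_…`: `= dim B · [K : K₁]²`
  («`½ e d² k²`»); **`finrank_neronSeveriGroup_eq_sq_mul_of_inducedCMType`**: `ρ(X) = [K : K₁]² · ρ(B)` for
  `B = ℂ^{Φ₁}/u(𝔪₁)` («`ρ(A^k) = ρ k²`»); `finrank_hodgeClasses_one_eq_of_inducedCMType` (`dim_ℚ B¹(X)`);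
  `…_of_isPrimitive` (the tree's group-theoretic `IsPrimitive`);
* `mul_div_two_le_finrank_neronSeveriGroup_of_inducedCMType` — `[K : K₀] · dim X ≤ ρ(X)` for EVERY inducing
  sub-pair `(K₀; Φ₀)` of `Φ`;
* for `K` a CM field (then every inducing subfield is CM, tree `isCMField_of_cmType_intermediateField`, and the
  primitive sub-pair exists, Streng I.3.5 = tree `exists_primitive_inducedCMType_eq_of_isCMField`):
  `exists_primitive_finrank_neronSeveriGroup_eq`, **`div_two_dvd_finrank_neronSeveriGroup`** (`dim X ∣ ρ(X)`),
  **`finrank_neronSeveriGroup_eq_div_two_iff_isSimple`** (`ρ(X) = dim X ⟺ X` simple — the converse of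
  `finrank_neronSeveriGroup_eq_of_isSimple`), **`finrank_neronSeveriGroup_eq_sq_iff_exists_quadratic`**
  (`ρ(X) = (dim X)² ⟺ Φ` is induced from an imaginary quadratic subfield — Lange 2023 §2.6.3 Exercise (2)
  (i) ⟺ (ii) «`ρ(X) = g²` ⟺ `X` is isogenous to `E^g` with an elliptic curve `E` with complex multiplication»
  read on the CM torus, whose isogeny factor for `Φ = Φ₀^K`, `[K₀ : ℚ] = 2`, is the CM curve `ℂ/u(𝔪₀)`, THM 3),
  and then, BY NAME from `Geometry/Kaehler/ComplexTorusHodgeClassesMaximalPicardNumber` (Lange 2023 §7.3.3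
  Exercise (3)), `divisorClasses_eq_hodgeClasses_of_inducedCMType_quadratic` (`Dᵖ(X) = H^{2p}_Hodge(X)`: every
  Hodge class on such a torus is a polynomial in divisor classes — a KNOWN case, Tate / Murasaki / van Geemen
  Thm. 4.3; tree on the variety carrier: `EndFieldFullDegree.hodgeConjectureFor_of_inducedCMType_eq_cmTypeOfPair`)
  and `finrank_hodgeClasses_eq_choose_sq_of_inducedCMType_quadratic` (`dim_ℚ = C(g,p)²`, HL19 Cor. 2.6 `k²` at
  `p = 1`).

Related, BY NAME (different carriers, not restated): the Albert-type form «CM centre ⟹ `ρ(X) = ½ dim_ℚ End_ℚ(X)`»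
of a simple polarised torus, `Geometry/Kaehler/ComplexTorusPicardNumberAlbertTypes` (Lange 2023 §2.6.1 Prop., line
4 «`ρ = e₀d²`»); `End_ℚ(ℂ^Φ/D(𝔞)) ≅ M_h(K₁)` for an induced type, `NumberTheory/ComplexMultiplication/
CMTorusEndomorphismAlgebraInducedType`; `ρ(Eⁿ) = n²` for the tori `E_τⁿ`, `E_τ` CM,
`Geometry/Kaehler/ComplexTorusHodgeClassesMaximalPicardNumber` §5; `ρ ≤ g²` for every torus,
`ComplexTorus.finrank_neronSeveriGroup_le_sq`.  NOT here: Murty's types I–III and type IV with `d > 1` (they need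
the Albert classification at torus level — the lane's FREE pointer «HL19 Prop. 2.4 / Cor. 2.5 by Albert type»);
the higher Pohlmann sets `pohlmannSets (Φ₁^K) p`, `p ≥ 2`, which are NOT determined by pairs in general.

## References
* [Murty1984] V. K. Murty, *Exceptional Hodge classes on certain abelian varieties*, Math. Ann. 268 (1984)
  197–206 — Lemma 3.3 (not held; read through [HulekLaface2019PicardNumbers]).
* [HulekLaface2019PicardNumbers] K. Hulek, R. Laface, *On the Picard numbers of abelian varieties*, Ann. Sc. Norm. Super. Pisa
  Cl. Sci. (5) 19 (2019) 1199–1224, arXiv:1703.05882 — Prop. 2.4, Cor. 2.5 (proof), Cor. 2.6 (held, p0006).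
* [Pohlmann1968] H. Pohlmann, Ann. of Math. (2) 88 (1968) 161–180 — Thm. 1.
* [Gordon1999HodgeAVSurvey] B. B. Gordon, *A survey of the Hodge conjecture for abelian varieties* (1999) — §9.2
  Theorem ([B.88] Thm. 1), 9.2.2 (held `paper:arxiv-alg-geom_9709030` p0024).
* [Shimura1998] G. Shimura, *Abelian Varieties with Complex Multiplication and Modular Functions* (1998) — §5.1
  Prop. 6, §6.2 Thm. 3 (p. 42), §8.2 Prop. 26 (p. 69).
* [Streng2010] M. Streng, *Complex multiplication of abelian surfaces* (2010) — Ch. I Def. 3.2, Lemma 3.5.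
* [Lange2023AbelianVarietiesComplex] H. Lange, *Abelian Varieties over the Complex Numbers* (2023) — §2.6.3
  Exercise (2) (held text p0147), §1.3.4 Exercise (10)(b) (p0042), §2.6.1 Proposition (p0138), §7.3.3 Exercise (3).
* [Garling2021] D. J. H. Garling, *Galois Theory and Its Algebraic Background*, 2nd ed. (2021) — Thm. 8.3 (p. 89:
  a separable extension of degree `d` has exactly `d` monomorphisms into a splitting field extending `j`).

## Provenance
Lane `lit-hodgefound`, prover seat `lit-hodgefound-p29` (generation 9), row g9-#1 (lane INBOX claim l.4613);
consumes BY NAME `CMTorusHodgeClassesPohlmann` (`CMTorus.finrank_neronSeveriGroup_eq_ncard_pohlmannSets`,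
`finrank_hodgeClasses_eq_ncard_pohlmannSets`, `ncard_pohlmannSets_one_eq_of_primitive`),
`Pohlmann1968/MumfordSimpleFourfoldOfPrimitive` (`comp_conjugate_eq`), `NumberTheory/ComplexMultiplication/
CMTypeInducedFromPrimitive` (`exists_primitive_inducedCMType_eq_of_isCMField`, `isCMField_of_cmType_intermediateField`),
`CMTorusAbelianVarietyOrder` (`CMTypeLattice.isSimple_periodEquiv_iff`, `…_iff_not_exists_inducedCMType`),
`Geometry/Kaehler/ComplexTorusHodgeClassesMaximalPicardNumber`.
-/

noncomputable section

-- Nested instance problems on the carriers `↥(ComplexTorus.rationalForms P k)`, cf. `CMTorusCohomologyOfCMType`.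
set_option maxSynthPendingDepth 3

open scoped Classical
open NumberField Module

/-! ## §1 The balanced pairs of an induced type -/

namespace Literature.AlgebraicGeometry.Pohlmann1968

open Literature.AlgebraicGeometry.Motives (CMType)
open Literature.NumberTheory.ComplexMultiplication (inducedCMType mem_inducedCMType_iff conjugate_comp_ringHom)

section Pairs

variable {K : Type} [Field K] {K₁ : Type} [Field K₁] [NumberField K₁] [IsCMField K₁] (j : K₁ →+* K)
  (Φ₁ : CMType K₁)

omit [NumberField K₁] [IsCMField K₁] in
include Φ₁ in
/-- An embedding of a field carrying a CM type differs from its conjugate (`χ ∈ Φ₁ ↔ χ̄ ∉ Φ₁`). [folklore] -/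
private theorem ne_conjugate₁ (χ : K₁ →+* ℂ) : χ ≠ ComplexEmbedding.conjugate χ := by
  intro h
  have h2 := Φ₁.2 χ
  rw [← h] at h2
  exact iff_not_self h2

omit [NumberField K₁] [IsCMField K₁] in
/-- `χ̄ ∈ Φ₁ ⟺ χ ∉ Φ₁` for a CM type. [folklore] -/
private theorem conjugate_mem_cmType_iff_not_mem (χ : K₁ →+* ℂ) :
    ComplexEmbedding.conjugate χ ∈ Φ₁.1 ↔ χ ∉ Φ₁.1 :=
  (Φ₁.2 χ).not_left.symm

omit [NumberField K₁] [IsCMField K₁] in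
include Φ₁ in
/-- If `ψ|_{K₁} = (φ|_{K₁})‾` then `φ ≠ ψ`. [folklore] -/
private theorem ne_of_comp_eq_conjugate {φ ψ : K →+* ℂ} (h : ψ.comp j = ComplexEmbedding.conjugate (φ.comp j)) :
    φ ≠ ψ := by
  rintro rfl
  exact ne_conjugate₁ Φ₁ (φ.comp j) h

/-- Counting the members of a pair with a property. [folklore] -/
private theorem ncard_sep_pair' {a b : K →+* ℂ} (hab : a ≠ b) (Q : (K →+* ℂ) → Prop) :
    {x | x ∈ ({a, b} : Finset (K →+* ℂ)) ∧ Q x}.ncard = (if Q a then 1 else 0) + (if Q b then 1 else 0) := by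
  rw [show {x | x ∈ ({a, b} : Finset (K →+* ℂ)) ∧ Q x} = ↑(({a, b} : Finset (K →+* ℂ)).filter Q) by
      rw [Finset.coe_filter], Set.ncard_coe_finset, Finset.filter_insert, Finset.filter_singleton]
  by_cases ha : Q a <;> by_cases hb : Q b <;> simp [ha, hb, hab]

omit [NumberField K₁] [IsCMField K₁] in
/-- `τ ∘ φ ∈ Φ₁^K ⟺ τ ∘ (φ ∘ j) ∈ Φ₁`: the induced type only sees restrictions. [cite: Streng2010, Ch. I Def. 3.2] -/
theorem comp_mem_inducedCMType_iff (τ : ℂ ≃+* ℂ) (φ : K →+* ℂ) :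
    (τ : ℂ →+* ℂ).comp φ ∈ (inducedCMType j Φ₁).1 ↔ (τ : ℂ →+* ℂ).comp (φ.comp j) ∈ Φ₁.1 := by
  rw [mem_inducedCMType_iff, RingHom.comp_assoc]

/-- For `ψ|_{K₁} = (φ|_{K₁})‾` and every `τ ∈ Aut(ℂ)`: `τψ ∈ Φ₁^K ⟺ τφ ∉ Φ₁^K` (on the CM field `K₁`,
`τ ∘ χ̄ = (τ ∘ χ)‾`, and `χ ∈ Φ₁ ⟺ χ̄ ∉ Φ₁`). [cite: Shimura1998, §8.1 Prop. 25 and §5.2] -/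
theorem comp_mem_inducedCMType_iff_not_of_comp_eq_conjugate {φ ψ : K →+* ℂ}
    (h : ψ.comp j = ComplexEmbedding.conjugate (φ.comp j)) (τ : ℂ ≃+* ℂ) :
    (τ : ℂ →+* ℂ).comp ψ ∈ (inducedCMType j Φ₁).1 ↔ (τ : ℂ →+* ℂ).comp φ ∉ (inducedCMType j Φ₁).1 := by
  rw [comp_mem_inducedCMType_iff, comp_mem_inducedCMType_iff, h, comp_conjugate_eq,
    conjugate_mem_cmType_iff_not_mem]

/-- **Pairs over conjugate pairs are balanced** (EVERY inducing pair, no primitivity): if `ψ|_{K₁} = (φ|_{K₁})‾`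
then `{φ, ψ}` is a balanced pair of the induced type `Φ₁^K` — for each `τ ∈ Aut(ℂ)` exactly one of `τφ`, `τψ`
lies in `Φ₁^K`.  (The case `K₁ = K` is the tree's `pair_conjugate_mem_pohlmannSets_one`: the conjugate pairs.)
[cite: Pohlmann1968, Thm. 1] [cite: Gordon1999HodgeAVSurvey, §9.2 (9.2.1) and 9.2.2] -/
theorem pair_mem_pohlmannSets_one_inducedCMType {φ ψ : K →+* ℂ}
    (h : ψ.comp j = ComplexEmbedding.conjugate (φ.comp j)) :
    ({φ, ψ} : Finset (K →+* ℂ)) ∈ pohlmannSets (inducedCMType j Φ₁) 1 := by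
  have hne := ne_of_comp_eq_conjugate j Φ₁ h
  refine ⟨Finset.card_pair hne, fun τ => ?_⟩
  rw [ncard_sep_pair' hne, ncard_sep_pair' hne, comp_mem_inducedCMType_iff_not_of_comp_eq_conjugate j Φ₁ h τ]
  by_cases hφ : (τ : ℂ →+* ℂ).comp φ ∈ (inducedCMType j Φ₁).1 <;> simp [hφ]

/-- **The balanced pairs of an induced type** `Φ₁^K`: `Δ` is balanced iff `Δ = {φ, ψ}` with `φ ≠ ψ` and, for every
`τ ∈ Aut(ℂ)`, `τ(ψ|_{K₁}) ∈ Φ₁ ⟺ τ(φ|_{K₁})‾ ∈ Φ₁` — the restrictions `ψ|_{K₁}` and `(φ|_{K₁})‾` are not separated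
by the translates of `Φ₁` (Pohlmann's condition (9.2.1) for `|Δ| = 2` says: exactly one of `τφ`, `τψ` lies in
`Φ₁^K`, and membership in `Φ₁^K` is read on `K₁`). [cite: Pohlmann1968, Thm. 1] [cite: Gordon1999HodgeAVSurvey, §9.2 (9.2.1)] -/
theorem mem_pohlmannSets_one_inducedCMType_iff (Δ : Finset (K →+* ℂ)) :
    Δ ∈ pohlmannSets (inducedCMType j Φ₁) 1 ↔ ∃ φ ψ : K →+* ℂ, φ ≠ ψ ∧ Δ = {φ, ψ} ∧
      ∀ τ : ℂ ≃+* ℂ, (τ : ℂ →+* ℂ).comp (ψ.comp j) ∈ Φ₁.1 ↔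
        (τ : ℂ →+* ℂ).comp (ComplexEmbedding.conjugate (φ.comp j)) ∈ Φ₁.1 := by
  constructor
  · rintro ⟨hcard, hbal⟩
    obtain ⟨φ, ψ, hne, rfl⟩ := Finset.card_eq_two.1 hcard
    refine ⟨φ, ψ, hne, rfl, fun τ => ?_⟩
    have hb := hbal τ
    rw [ncard_sep_pair' hne, ncard_sep_pair' hne] at hb
    rw [comp_conjugate_eq, conjugate_mem_cmType_iff_not_mem, ← RingHom.comp_assoc,
      ← RingHom.comp_assoc, ← mem_inducedCMType_iff j, ← mem_inducedCMType_iff j]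
    by_cases hφ : (τ : ℂ →+* ℂ).comp φ ∈ (inducedCMType j Φ₁).1 <;>
      by_cases hψ : (τ : ℂ →+* ℂ).comp ψ ∈ (inducedCMType j Φ₁).1 <;> simp [hφ, hψ] at hb ⊢
  · rintro ⟨φ, ψ, hne, rfl, hτ⟩
    refine ⟨Finset.card_pair hne, fun τ => ?_⟩
    rw [ncard_sep_pair' hne, ncard_sep_pair' hne]
    have hψ : (τ : ℂ →+* ℂ).comp ψ ∈ (inducedCMType j Φ₁).1 ↔ (τ : ℂ →+* ℂ).comp φ ∉ (inducedCMType j Φ₁).1 := by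
      rw [comp_mem_inducedCMType_iff, comp_mem_inducedCMType_iff, hτ τ, comp_conjugate_eq,
        conjugate_mem_cmType_iff_not_mem]
    rw [hψ]
    by_cases hφ : (τ : ℂ →+* ℂ).comp φ ∈ (inducedCMType j Φ₁).1 <;> simp [hφ]

/-- **For a PRIMITIVE `Φ₁` the balanced pairs of `Φ₁^K` are exactly the pairs `{φ, ψ}` with `ψ|_{K₁} = (φ|_{K₁})‾`**
(the translates of a primitive type separate the embeddings of `K₁` — Shimura §8.2 Prop. 26 «`H₁ = H'`» in the
`Aut(ℂ)`-form `hprim` used throughout the lane; for `K₁ = K` this is the tree's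
`mem_pohlmannSets_one_iff_of_primitive`, the conjugate pairs). [cite: Shimura1998, §8.2 Prop. 26]
[cite: Gordon1999HodgeAVSurvey, 9.2.2] [cite: Pohlmann1968, Thm. 1] -/
theorem mem_pohlmannSets_one_inducedCMType_iff_of_primitive
    (hprim : ∀ s t : K₁ →+* ℂ,
      (∀ τ : ℂ ≃+* ℂ, (τ : ℂ →+* ℂ).comp s ∈ Φ₁.1 ↔ (τ : ℂ →+* ℂ).comp t ∈ Φ₁.1) → s = t)
    (Δ : Finset (K →+* ℂ)) :
    Δ ∈ pohlmannSets (inducedCMType j Φ₁) 1 ↔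
      ∃ φ ψ : K →+* ℂ, ψ.comp j = ComplexEmbedding.conjugate (φ.comp j) ∧ Δ = {φ, ψ} := by
  rw [mem_pohlmannSets_one_inducedCMType_iff]
  constructor
  · rintro ⟨φ, ψ, -, rfl, hτ⟩
    exact ⟨φ, ψ, hprim _ _ hτ, rfl⟩
  · rintro ⟨φ, ψ, h, rfl⟩
    exact ⟨φ, ψ, ne_of_comp_eq_conjugate j Φ₁ h, rfl, fun τ => by rw [h]⟩

omit [NumberField K₁] [IsCMField K₁] in
/-- If `ψ|_{K₁} = (φ|_{K₁})‾` then exactly one of `φ`, `ψ` lies in `Φ₁^K`: `ψ ∈ Φ₁^K ⟺ φ ∉ Φ₁^K`. [folklore] -/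
private theorem mem_inducedCMType_iff_not_of_comp_eq_conjugate {φ ψ : K →+* ℂ}
    (h : ψ.comp j = ComplexEmbedding.conjugate (φ.comp j)) :
    ψ ∈ (inducedCMType j Φ₁).1 ↔ φ ∉ (inducedCMType j Φ₁).1 := by
  rw [mem_inducedCMType_iff, mem_inducedCMType_iff, h, conjugate_mem_cmType_iff_not_mem]

/-- The same description NORMALISED by the member lying in `Φ₁^K` (a balanced pair has exactly one member in the
type, `τ = 1`): for `Φ₁` primitive, `Δ` is a balanced pair of `Φ₁^K` iff `Δ = {φ, ψ}` with `φ ∈ Φ₁^K` and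
`ψ|_{K₁} = (φ|_{K₁})‾`. [cite: Pohlmann1968, Thm. 1] [cite: Shimura1998, §8.2 Prop. 26] -/
theorem mem_pohlmannSets_one_inducedCMType_iff_of_primitive'
    (hprim : ∀ s t : K₁ →+* ℂ,
      (∀ τ : ℂ ≃+* ℂ, (τ : ℂ →+* ℂ).comp s ∈ Φ₁.1 ↔ (τ : ℂ →+* ℂ).comp t ∈ Φ₁.1) → s = t)
    (Δ : Finset (K →+* ℂ)) :
    Δ ∈ pohlmannSets (inducedCMType j Φ₁) 1 ↔ ∃ φ ψ : K →+* ℂ, φ ∈ (inducedCMType j Φ₁).1 ∧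
      ψ.comp j = ComplexEmbedding.conjugate (φ.comp j) ∧ Δ = {φ, ψ} := by
  rw [mem_pohlmannSets_one_inducedCMType_iff_of_primitive j Φ₁ hprim]
  constructor
  · rintro ⟨φ, ψ, h, rfl⟩
    by_cases hφ : φ ∈ (inducedCMType j Φ₁).1
    · exact ⟨φ, ψ, hφ, h, rfl⟩
    · refine ⟨ψ, φ, (mem_inducedCMType_iff_not_of_comp_eq_conjugate j Φ₁ h).2 hφ, ?_, Finset.pair_comm _ _⟩
      rw [h, (ComplexEmbedding.involutive_conjugate K₁) (φ.comp j)]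
  · rintro ⟨φ, ψ, -, h, rfl⟩
    exact ⟨φ, ψ, h, rfl⟩

end Pairs

/-! ## §2 The count: `#(balanced pairs of Φ₁^K) = [K : K₁] · [K : ℚ]/2` -/

section Count

variable {K : Type} [Field K] [NumberField K] {K₁ : Type} [Field K₁] [NumberField K₁] [Algebra K₁ K]
  (Φ₁ : CMType K₁)

/-- **Every complex embedding of `K₁` has exactly `[K : K₁]` extensions to `K`** (`#Hom_{K₁}(K, ℂ) = [K : K₁]`,
`ℂ` algebraically closed of characteristic `0`; Mathlib `AlgHom.card`) — Garling, Thm. 8.3: «there are exactly `d`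
monomorphisms from `K'` to `L` extending `j`». [cite: Garling2021, Thm. 8.3 (p. 89)] -/
theorem card_filter_comp_algebraMap_eq_finrank (χ : K₁ →+* ℂ) :
    (Finset.univ.filter fun ψ : K →+* ℂ => ψ.comp (algebraMap K₁ K) = χ).card = finrank K₁ K := by
  letI : Algebra K₁ ℂ := χ.toAlgebra
  have e : {ψ : K →+* ℂ // ψ.comp (algebraMap K₁ K) = χ} ≃ (K →ₐ[K₁] ℂ) :=
    { toFun := fun ψ => ⟨ψ.1, fun x => RingHom.congr_fun ψ.2 x⟩
      invFun := fun f => ⟨f.toRingHom, RingHom.ext fun x => f.commutes x⟩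
      left_inv := fun ψ => rfl
      right_inv := fun f => rfl }
  rw [← Fintype.card_subtype, Fintype.card_congr e, AlgHom.card]

variable [IsCMField K₁]

/-- The balanced pairs of `Φ₁^K` as the image of `{(φ, ψ) | φ ∈ Φ₁^K, ψ|_{K₁} = (φ|_{K₁})‾}` under
`(φ, ψ) ↦ {φ, ψ}` (for `Φ₁` primitive). [cite: Pohlmann1968, Thm. 1] -/
private theorem pohlmannSets_one_inducedCMType_eq_coe_image
    (hprim : ∀ s t : K₁ →+* ℂ,
      (∀ τ : ℂ ≃+* ℂ, (τ : ℂ →+* ℂ).comp s ∈ Φ₁.1 ↔ (τ : ℂ →+* ℂ).comp t ∈ Φ₁.1) → s = t) :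
    pohlmannSets (inducedCMType (algebraMap K₁ K) Φ₁) 1 =
      ↑(((Finset.univ.filter fun φ : K →+* ℂ => φ ∈ (inducedCMType (algebraMap K₁ K) Φ₁).1).sigma
          fun φ => Finset.univ.filter fun ψ : K →+* ℂ =>
            ψ.comp (algebraMap K₁ K) = ComplexEmbedding.conjugate (φ.comp (algebraMap K₁ K))).image
        fun x => ({x.1, x.2} : Finset (K →+* ℂ))) := by
  ext Δ
  rw [mem_pohlmannSets_one_inducedCMType_iff_of_primitive' (algebraMap K₁ K) Φ₁ hprim, Finset.coe_image,
    Set.mem_image]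
  constructor
  · rintro ⟨φ, ψ, hφ, h, rfl⟩
    exact ⟨⟨φ, ψ⟩, Finset.mem_sigma.2 ⟨Finset.mem_filter.2 ⟨Finset.mem_univ _, hφ⟩,
      Finset.mem_filter.2 ⟨Finset.mem_univ _, h⟩⟩, rfl⟩
  · rintro ⟨⟨φ, ψ⟩, hx, rfl⟩
    simp only [Finset.coe_sigma, Set.mem_sigma_iff, Finset.coe_filter, Finset.mem_univ, true_and,
      Set.mem_setOf_eq] at hx
    exact ⟨φ, ψ, hx.1, hx.2, rfl⟩

omit [NumberField K₁] [IsCMField K₁] in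
/-- `(φ, ψ) ↦ {φ, ψ}` is injective on `{(φ, ψ) | φ ∈ Φ₁^K, ψ|_{K₁} = (φ|_{K₁})‾}` (then `ψ ∉ Φ₁^K`). [folklore] -/
private theorem injOn_pair_sigma :
    Set.InjOn (fun x : (_ : K →+* ℂ) × (K →+* ℂ) => ({x.1, x.2} : Finset (K →+* ℂ)))
      ↑((Finset.univ.filter fun φ : K →+* ℂ => φ ∈ (inducedCMType (algebraMap K₁ K) Φ₁).1).sigma
          fun φ => Finset.univ.filter fun ψ : K →+* ℂ =>
            ψ.comp (algebraMap K₁ K) = ComplexEmbedding.conjugate (φ.comp (algebraMap K₁ K))) := by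
  rintro ⟨φ, ψ⟩ hx ⟨φ', ψ'⟩ hx' hpair
  simp only [Finset.coe_sigma, Set.mem_sigma_iff, Finset.coe_filter, Finset.mem_univ, true_and,
    Set.mem_setOf_eq] at hx hx'
  have hψ : ψ ∉ (inducedCMType (algebraMap K₁ K) Φ₁).1 := fun h =>
    (mem_inducedCMType_iff_not_of_comp_eq_conjugate (algebraMap K₁ K) Φ₁ hx.2).1 h hx.1
  have hψ' : ψ' ∉ (inducedCMType (algebraMap K₁ K) Φ₁).1 := fun h =>
    (mem_inducedCMType_iff_not_of_comp_eq_conjugate (algebraMap K₁ K) Φ₁ hx'.2).1 h hx'.1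
  have hpair : ({φ, ψ} : Finset (K →+* ℂ)) = {φ', ψ'} := hpair
  have hφmem : φ ∈ ({φ', ψ'} : Finset (K →+* ℂ)) := hpair ▸ Finset.mem_insert_self _ _
  have hψmem : ψ ∈ ({φ', ψ'} : Finset (K →+* ℂ)) := hpair ▸ Finset.mem_insert_of_mem (Finset.mem_singleton_self _)
  rw [Finset.mem_insert, Finset.mem_singleton] at hφmem hψmem
  have hφ : φ = φ' := hφmem.resolve_right fun h => hψ' (h ▸ hx.1)
  have hψeq : ψ = ψ' := hψmem.resolve_left fun h => hψ (h ▸ hx'.1)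
  subst hφ hψeq
  rfl

omit [IsCMField K₁] [NumberField K₁] [Algebra K₁ K] in
/-- `#Φ = [K : ℚ]/2` for a CM type `Φ` of `K`, counted on `Finset.univ.filter (· ∈ Φ)`. [cite: Shimura1998, §5.2] -/
private theorem card_filter_mem_cmType (Φ : CMType K) :
    (Finset.univ.filter fun φ : K →+* ℂ => φ ∈ Φ.1).card = finrank ℚ K / 2 := by
  have h2 := Literature.AlgebraicGeometry.Motives.HodgeStructure.two_mul_ncard_cmType_eq_finrank Φ
  have hc : (Finset.univ.filter fun φ : K →+* ℂ => φ ∈ Φ.1).card = Φ.1.ncard := by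
    rw [Set.ncard_eq_toFinset_card', Set.filter_mem_univ_eq_toFinset]
  omega

/-- **The number of balanced pairs of an induced type: `#(pohlmannSets (Φ₁^K) 1) = [K : K₁] · [K : ℚ]/2`** for
`Φ₁` PRIMITIVE — each balanced pair is `{φ, ψ}` with a unique `φ ∈ Φ₁^K` (`[K : ℚ]/2` choices) and `ψ` one of
the `[K : K₁]` extensions of `(φ|_{K₁})‾`.  With `[K : ℚ]/2 = [K : K₁] · [K₁ : ℚ]/2` this is Murty's
`½ e d² k²` (`e = [K₁ : ℚ]`, `d = 1`, `k = [K : K₁]`). [cite: Murty1984, Lemma 3.3]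
[cite: HulekLaface2019PicardNumbers, Prop. 2.4 (Type IV)] [cite: Pohlmann1968, Thm. 1] -/
theorem ncard_pohlmannSets_one_inducedCMType_eq
    (hprim : ∀ s t : K₁ →+* ℂ,
      (∀ τ : ℂ ≃+* ℂ, (τ : ℂ →+* ℂ).comp s ∈ Φ₁.1 ↔ (τ : ℂ →+* ℂ).comp t ∈ Φ₁.1) → s = t) :
    (pohlmannSets (inducedCMType (algebraMap K₁ K) Φ₁) 1).ncard = finrank K₁ K * (finrank ℚ K / 2) := by
  rw [pohlmannSets_one_inducedCMType_eq_coe_image Φ₁ hprim, Set.ncard_coe_finset,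
    Finset.card_image_of_injOn (injOn_pair_sigma Φ₁), Finset.card_sigma,
    Finset.sum_congr rfl fun φ _ => card_filter_comp_algebraMap_eq_finrank (K := K)
      (ComplexEmbedding.conjugate (φ.comp (algebraMap K₁ K))),
    Finset.sum_const, smul_eq_mul, card_filter_mem_cmType, mul_comm]

/-- **`[K : K₁] · [K : ℚ]/2 ≤ #(pohlmannSets (Φ₁^K) 1)` for EVERY inducing pair `(K₁; Φ₁)`** (the pairs over
conjugate pairs are balanced, `pair_mem_pohlmannSets_one_inducedCMType`; no primitivity).
[cite: Pohlmann1968, Thm. 1] [cite: Gordon1999HodgeAVSurvey, 9.2.2] -/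
theorem mul_div_two_le_ncard_pohlmannSets_one_inducedCMType :
    finrank K₁ K * (finrank ℚ K / 2) ≤ (pohlmannSets (inducedCMType (algebraMap K₁ K) Φ₁) 1).ncard := by
  set S := ((Finset.univ.filter fun φ : K →+* ℂ => φ ∈ (inducedCMType (algebraMap K₁ K) Φ₁).1).sigma
      fun φ => Finset.univ.filter fun ψ : K →+* ℂ =>
        ψ.comp (algebraMap K₁ K) = ComplexEmbedding.conjugate (φ.comp (algebraMap K₁ K))) with hS
  have hsub : ↑(S.image fun x => ({x.1, x.2} : Finset (K →+* ℂ))) ⊆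
      pohlmannSets (inducedCMType (algebraMap K₁ K) Φ₁) 1 := by
    intro Δ hΔ
    rw [Finset.coe_image, Set.mem_image] at hΔ
    obtain ⟨⟨φ, ψ⟩, hx, rfl⟩ := hΔ
    rw [hS] at hx
    simp only [Finset.coe_sigma, Set.mem_sigma_iff, Finset.coe_filter, Finset.mem_univ, true_and,
      Set.mem_setOf_eq] at hx
    exact pair_mem_pohlmannSets_one_inducedCMType (algebraMap K₁ K) Φ₁ hx.2
  have hfin : (pohlmannSets (inducedCMType (algebraMap K₁ K) Φ₁) 1).Finite :=
    (Set.finite_univ (α := Finset (K →+* ℂ))).subset (Set.subset_univ _)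
  refine le_trans (le_of_eq ?_) (Set.ncard_le_ncard hsub hfin)
  rw [Set.ncard_coe_finset, Finset.card_image_of_injOn (hS ▸ injOn_pair_sigma Φ₁), hS, Finset.card_sigma,
    Finset.sum_congr rfl fun φ _ => card_filter_comp_algebraMap_eq_finrank (K := K)
      (ComplexEmbedding.conjugate (φ.comp (algebraMap K₁ K))),
    Finset.sum_const, smul_eq_mul, card_filter_mem_cmType, mul_comm]

omit [IsCMField K₁] in
/-- `[K : ℚ]/2 = [K : K₁] · [K₁ : ℚ]/2` when `[K₁ : ℚ]` is even (tower law). [folklore] -/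
private theorem finrank_div_two_eq_mul (h2 : 2 ∣ finrank ℚ K₁) :
    finrank ℚ K / 2 = finrank K₁ K * (finrank ℚ K₁ / 2) := by
  obtain ⟨m, hm⟩ := h2
  rw [← Module.finrank_mul_finrank ℚ K₁ K, hm]
  rw [show 2 * m * finrank K₁ K = 2 * (finrank K₁ K * m) by ring, Nat.mul_div_cancel_left _ two_pos,
    Nat.mul_div_cancel_left _ two_pos]

omit [NumberField K] [Algebra K₁ K] [IsCMField K₁] in
include Φ₁ in
/-- `[K₁ : ℚ]` is even for a field carrying a CM type. [cite: Shimura1998, §5.2] -/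
theorem two_dvd_finrank_of_cmType : 2 ∣ finrank ℚ K₁ :=
  ⟨Φ₁.1.ncard, (Literature.AlgebraicGeometry.Motives.HodgeStructure.two_mul_ncard_cmType_eq_finrank Φ₁).symm⟩

/-- Murty's form of the count: **`#(pohlmannSets (Φ₁^K) 1) = ([K₁ : ℚ]/2) · [K : K₁]²`** («`½ e d² k²`», `d = 1`).
[cite: Murty1984, Lemma 3.3] [cite: HulekLaface2019PicardNumbers, Prop. 2.4 (Type IV)] -/
theorem ncard_pohlmannSets_one_inducedCMType_eq_mul_sq
    (hprim : ∀ s t : K₁ →+* ℂ,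
      (∀ τ : ℂ ≃+* ℂ, (τ : ℂ →+* ℂ).comp s ∈ Φ₁.1 ↔ (τ : ℂ →+* ℂ).comp t ∈ Φ₁.1) → s = t) :
    (pohlmannSets (inducedCMType (algebraMap K₁ K) Φ₁) 1).ncard = (finrank ℚ K₁ / 2) * finrank K₁ K ^ 2 := by
  rw [ncard_pohlmannSets_one_inducedCMType_eq Φ₁ hprim, finrank_div_two_eq_mul (two_dvd_finrank_of_cmType Φ₁)]
  ring

end Count

end Literature.AlgebraicGeometry.Pohlmann1968

/-! ## §3 The Picard number of the CM tori of induced type -/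

namespace Literature.AlgebraicGeometry.ComplexMultiplication

open Literature.AlgebraicGeometry.Motives (CMType HodgeStructure)
open Literature.AlgebraicGeometry.Pohlmann1968
open Literature.Geometry.Kaehler
open Literature.NumberTheory.ComplexMultiplication (inducedCMType mem_inducedCMType_iff IsPrimitive
  isPrimitive_iff_forall_eq exists_primitive_inducedCMType_eq_of_isCMField isCMField_of_cmType_intermediateField)
open Literature.NumberTheory.ComplexMultiplication.CMTypeLattice (isSimple_periodEquiv_iff
  isSimple_periodEquiv_iff_not_exists_inducedCMType)
open scoped Literature.NumberTheory.ComplexMultiplication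

namespace CMTorus

section Induced

variable {K : Type} [Field K] [NumberField K] {ι : Type} [Fintype ι] (Φ : CMType K) (μ : Basis ι ℚ K)
  {K₁ : Type} [Field K₁] [NumberField K₁] [IsCMField K₁] [Algebra K₁ K] {Φ₁ : CMType K₁}

/-- **`[K : K₁] · dim X ≤ ρ(ℂ^Φ/u(𝔪))` for EVERY inducing sub-pair `(K₁; Φ₁)` of `Φ`** (`dim X = [K : ℚ]/2`):
the `[K : K₁] · dim X` pairs `{φ, ψ}`, `ψ|_{K₁} = (φ|_{K₁})‾`, are balanced, hence independent divisor classes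
by Pohlmann's count (`CMTorus.finrank_neronSeveriGroup_eq_ncard_pohlmannSets`).  For `K₁ = K` this is the
tree's `div_two_le_finrank_neronSeveriGroup` (`ρ ≥ dim X`). [cite: Pohlmann1968, Thm. 1]
[cite: Gordon1999HodgeAVSurvey, §9.2 Theorem ([B.88] Thm.1) and 9.2.2] -/
theorem mul_div_two_le_finrank_neronSeveriGroup_of_inducedCMType
    (hΦ : inducedCMType (algebraMap K₁ K) Φ₁ = Φ) :
    finrank K₁ K * (finrank ℚ K / 2) ≤ finrank ℤ (ComplexTorus.neronSeveriGroup (periodEquiv Φ μ)) := by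
  rw [finrank_neronSeveriGroup_eq_ncard_pohlmannSets, ← hΦ]
  exact mul_div_two_le_ncard_pohlmannSets_one_inducedCMType Φ₁

/-- **Murty 1984, Lemma 3.3 (type IV, `d = 1`) / Shimura §6.2 THM 3 for the CM torus of an INDUCED type:
`ρ(ℂ^Φ/u(𝔪)) = [K : K₁] · dim X`** for `Φ = Φ₁^K` induced from a PRIMITIVE pair `(K₁; Φ₁)` — `X ≅ B^h`,
`h = [K : K₁]`, `B = ℂ^{Φ₁}/u(𝔪₁)` simple with `End_ℚ(B) = K₁`, and «`ρ(A^k) = ½ e d² k²`» with `e = [K₁ : ℚ] =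
2 dim B`, `d = 1`, `k = h` gives `h² dim B = h dim X`.  Proof: Pohlmann's count and §2. [cite: Murty1984, Lemma 3.3]
[cite: HulekLaface2019PicardNumbers, Prop. 2.4 (Type IV)] [cite: Shimura1998, §6.2 Thm. 3 (p. 42) and §8.2 Prop. 26]
[cite: Pohlmann1968, Thm. 1] -/
theorem finrank_neronSeveriGroup_eq_of_inducedCMType (hΦ : inducedCMType (algebraMap K₁ K) Φ₁ = Φ)
    (hprim : ∀ s t : K₁ →+* ℂ,
      (∀ τ : ℂ ≃+* ℂ, (τ : ℂ →+* ℂ).comp s ∈ Φ₁.1 ↔ (τ : ℂ →+* ℂ).comp t ∈ Φ₁.1) → s = t) :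
    finrank ℤ (ComplexTorus.neronSeveriGroup (periodEquiv Φ μ)) = finrank K₁ K * (finrank ℚ K / 2) := by
  rw [finrank_neronSeveriGroup_eq_ncard_pohlmannSets, ← hΦ]
  exact ncard_pohlmannSets_one_inducedCMType_eq Φ₁ hprim

/-- Murty's own normal form: **`ρ(ℂ^Φ/u(𝔪)) = dim B · [K : K₁]²`**, `dim B = [K₁ : ℚ]/2` («`½ e d² k²`, Type IV»,
`d = 1`). [cite: Murty1984, Lemma 3.3] [cite: HulekLaface2019PicardNumbers, Prop. 2.4 (Type IV)] -/
theorem finrank_neronSeveriGroup_eq_mul_sq_of_inducedCMType (hΦ : inducedCMType (algebraMap K₁ K) Φ₁ = Φ)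
    (hprim : ∀ s t : K₁ →+* ℂ,
      (∀ τ : ℂ ≃+* ℂ, (τ : ℂ →+* ℂ).comp s ∈ Φ₁.1 ↔ (τ : ℂ →+* ℂ).comp t ∈ Φ₁.1) → s = t) :
    finrank ℤ (ComplexTorus.neronSeveriGroup (periodEquiv Φ μ)) = (finrank ℚ K₁ / 2) * finrank K₁ K ^ 2 := by
  rw [finrank_neronSeveriGroup_eq_ncard_pohlmannSets, ← hΦ]
  exact ncard_pohlmannSets_one_inducedCMType_eq_mul_sq Φ₁ hprim

/-- **`ρ(X) = [K : K₁]² · ρ(B)`** for `X = ℂ^{Φ₁^K}/u(𝔪)` and the SIMPLE torus `B = ℂ^{Φ₁}/u(𝔪₁)` of the primitive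
sub-pair (any lattices `𝔪 ⊂ K`, `𝔪₁ ⊂ K₁`): Hulek–Laface's «`ρ(A^k) = ρ k²` (Type IV)» for `A = B`, `X ∼ B^k`
(THM 3), with `ρ(B) = dim B` (tree `finrank_neronSeveriGroup_eq_of_isSimple`). [cite: HulekLaface2019PicardNumbers, Cor. 2.5 (proof, Type IV line)]
[cite: Murty1984, Lemma 3.3] [cite: Shimura1998, §6.2 Thm. 3] -/
theorem finrank_neronSeveriGroup_eq_sq_mul_of_inducedCMType {ι₁ : Type} [Fintype ι₁] (μ₁ : Basis ι₁ ℚ K₁)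
    (hΦ : inducedCMType (algebraMap K₁ K) Φ₁ = Φ)
    (hprim : ∀ s t : K₁ →+* ℂ,
      (∀ τ : ℂ ≃+* ℂ, (τ : ℂ →+* ℂ).comp s ∈ Φ₁.1 ↔ (τ : ℂ →+* ℂ).comp t ∈ Φ₁.1) → s = t) :
    finrank ℤ (ComplexTorus.neronSeveriGroup (periodEquiv Φ μ)) =
      finrank K₁ K ^ 2 * finrank ℤ (ComplexTorus.neronSeveriGroup (periodEquiv Φ₁ μ₁)) := by
  rw [finrank_neronSeveriGroup_eq_mul_sq_of_inducedCMType Φ μ hΦ hprim,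
    finrank_neronSeveriGroup_eq_ncard_pohlmannSets, ncard_pohlmannSets_one_eq_of_primitive Φ₁ hprim, mul_comm]

/-- … and `dim_ℚ B¹(X) = [K : K₁] · dim X` for the divisor Hodge classes `B¹(X) = H²(X, ℚ) ∩ H^{1,1}(X)`.
[cite: Murty1984, Lemma 3.3] [cite: Pohlmann1968, Thm. 1] -/
theorem finrank_hodgeClasses_one_eq_of_inducedCMType (hΦ : inducedCMType (algebraMap K₁ K) Φ₁ = Φ)
    (hprim : ∀ s t : K₁ →+* ℂ,
      (∀ τ : ℂ ≃+* ℂ, (τ : ℂ →+* ℂ).comp s ∈ Φ₁.1 ↔ (τ : ℂ →+* ℂ).comp t ∈ Φ₁.1) → s = t) :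
    finrank ℚ (ComplexTorus.hodgeClasses (periodEquiv Φ μ) 1) = finrank K₁ K * (finrank ℚ K / 2) := by
  rw [finrank_hodgeClasses_eq_ncard_pohlmannSets, ← hΦ]
  exact ncard_pohlmannSets_one_inducedCMType_eq Φ₁ hprim

/-- The same with the tree's group-theoretic `IsPrimitive` over `Aut(ℂ)` (any base embedding `s₀` of `K₁`).
[cite: Shimura1998, §8.2 Prop. 26] [cite: Murty1984, Lemma 3.3] -/
theorem finrank_neronSeveriGroup_eq_of_inducedCMType_of_isPrimitive
    (hΦ : inducedCMType (algebraMap K₁ K) Φ₁ = Φ) (s₀ : K₁ →+* ℂ) (hprim : IsPrimitive (ℂ ≃+* ℂ) Φ₁.1 s₀) :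
    finrank ℤ (ComplexTorus.neronSeveriGroup (periodEquiv Φ μ)) = finrank K₁ K * (finrank ℚ K / 2) := by
  haveI := isPretransitive_ringEquiv_complex (K := K₁)
  exact finrank_neronSeveriGroup_eq_of_inducedCMType Φ μ hΦ ((isPrimitive_iff_forall_eq Φ₁.1 s₀).1 hprim)

end Induced

/-! ### For a CM field `K`: `dim X ∣ ρ(X)`, `ρ(X) = dim X ⟺ X` simple, `ρ(X) = (dim X)² ⟺ Φ` comes from an
imaginary quadratic subfield -/

section CMField

variable {K : Type} [Field K] [NumberField K] [IsCMField K] {ι : Type} [Fintype ι] (Φ : CMType K)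
  (μ : Basis ι ℚ K)

/-- **`ρ(ℂ^Φ/u(𝔪)) = [K : K₁] · dim X` for THE primitive sub-pair `(K₁; Φ₁)` of `Φ`** (it exists and is a CM
pair: Streng I.3.5, tree `exists_primitive_inducedCMType_eq_of_isCMField`). [cite: Murty1984, Lemma 3.3]
[cite: Streng2010, Ch. I Lemma 3.5] [cite: Shimura1998, §6.2 Thm. 3] -/
theorem exists_primitive_finrank_neronSeveriGroup_eq :
    ∃ (K₁ : IntermediateField ℚ K) (Φ₁ : CMType K₁), inducedCMType (algebraMap K₁ K) Φ₁ = Φ ∧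
      (∀ s t : K₁ →+* ℂ,
        (∀ τ : ℂ ≃+* ℂ, (τ : ℂ →+* ℂ).comp s ∈ Φ₁.1 ↔ (τ : ℂ →+* ℂ).comp t ∈ Φ₁.1) → s = t) ∧
      finrank ℤ (ComplexTorus.neronSeveriGroup (periodEquiv Φ μ)) = finrank K₁ K * (finrank ℚ K / 2) := by
  obtain ⟨K₁, Φ₁, hK₁, hΦ, hprim, -⟩ := exists_primitive_inducedCMType_eq_of_isCMField Φ
  haveI := hK₁
  exact ⟨K₁, Φ₁, hΦ, hprim, finrank_neronSeveriGroup_eq_of_inducedCMType Φ μ hΦ hprim⟩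

/-- **`dim X ∣ ρ(X)`** for every CM torus `X = ℂ^Φ/u(𝔪)` of a CM field (`ρ = [K : K₁] · dim X`).
[cite: Murty1984, Lemma 3.3] [cite: HulekLaface2019PicardNumbers, Prop. 2.4 (Type IV)] -/
theorem div_two_dvd_finrank_neronSeveriGroup :
    finrank ℚ K / 2 ∣ finrank ℤ (ComplexTorus.neronSeveriGroup (periodEquiv Φ μ)) := by
  obtain ⟨K₁, Φ₁, -, -, h⟩ := exists_primitive_finrank_neronSeveriGroup_eq Φ μ
  exact ⟨finrank K₁ K, by rw [h, mul_comm]⟩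

omit [IsCMField K] in
include Φ in
/-- `dim X = [K : ℚ]/2 > 0`. [folklore] -/
private theorem div_two_pos : 0 < finrank ℚ K / 2 := by
  have h2 := HodgeStructure.two_mul_ncard_cmType_eq_finrank Φ
  have hpos : 0 < finrank ℚ K := finrank_pos
  omega

/-- **`ρ(X) = dim X ⟺ X` is simple**, for the CM torus `X = ℂ^Φ/u(𝔪)` of a CM field: `⟸` is the tree's
`finrank_neronSeveriGroup_eq_of_isSimple` (Lange 2023 §2.6.1 Prop., line 4, `d = 1`); `⟹`: a non-simple `X` has
`Φ = Φ₀^K` for a proper subfield `K₀` (THM 3, tree `isSimple_periodEquiv_iff_not_exists_inducedCMType`), and then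
`ρ(X) ≥ [K : K₀] · dim X ≥ 2 dim X`. [cite: Murty1984, Lemma 3.3] [cite: Shimura1998, §6.2 Thm. 3 and §8.2 Prop. 26]
[cite: Lange2023AbelianVarietiesComplex, §2.6.1 Proposition, line 4] -/
theorem finrank_neronSeveriGroup_eq_div_two_iff_isSimple [DecidableEq ι] :
    finrank ℤ (ComplexTorus.neronSeveriGroup (periodEquiv Φ μ)) = finrank ℚ K / 2 ↔
      ComplexTorus.IsSimple (periodEquiv Φ μ) := by
  refine ⟨fun h => ?_, finrank_neronSeveriGroup_eq_of_isSimple Φ μ⟩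
  rw [isSimple_periodEquiv_iff_not_exists_inducedCMType]
  rintro ⟨K₀, Φ₀, hK₀, hΦ⟩
  haveI := isCMField_of_cmType_intermediateField K₀ Φ₀
  have hle := mul_div_two_le_finrank_neronSeveriGroup_of_inducedCMType Φ μ hΦ
  rw [h] at hle
  have h1 : finrank K₀ K ≤ 1 := Nat.le_of_mul_le_mul_right
    (le_trans hle (le_of_eq (one_mul _).symm)) (div_two_pos Φ)
  have hone : finrank K₀ K = 1 := le_antisymm h1 finrank_pos
  exact hK₀ (IntermediateField.finrank_eq_one_iff_eq_top.1 hone)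

/-- On a quadratic field, two embeddings not separated by the translates of a CM type coincide (the two
embeddings `χ`, `χ̄` are separated at `τ = 1`): every CM type of an imaginary quadratic field is primitive.
[cite: Shimura1998, §8.2 p. 69 and §8.4 Example (1)] -/
theorem primitive_of_finrank_eq_two {K₀ : Type} [Field K₀] [NumberField K₀] (hK₀ : finrank ℚ K₀ = 2)
    (Φ₀ : CMType K₀) (s t : K₀ →+* ℂ)
    (hst : ∀ τ : ℂ ≃+* ℂ, (τ : ℂ →+* ℂ).comp s ∈ Φ₀.1 ↔ (τ : ℂ →+* ℂ).comp t ∈ Φ₀.1) : s = t := by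
  by_contra hne
  -- `Hom(K₀, ℂ) = {s, s̄}`, so `t = s̄`
  have hcard : Fintype.card (K₀ →+* ℂ) = 2 := by rw [Embeddings.card, hK₀]
  have hsc : s ≠ ComplexEmbedding.conjugate s := by
    intro h
    have h2 := Φ₀.2 s
    rw [← h] at h2
    exact iff_not_self h2
  have huniv : (Finset.univ : Finset (K₀ →+* ℂ)) = {s, ComplexEmbedding.conjugate s} :=
    (Finset.eq_univ_of_card _ (by rw [Finset.card_pair hsc, hcard])).symm
  have ht : t ∈ ({s, ComplexEmbedding.conjugate s} : Finset (K₀ →+* ℂ)) := huniv ▸ Finset.mem_univ t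
  rw [Finset.mem_insert, Finset.mem_singleton] at ht
  rcases ht with ht | ht
  · exact hne ht.symm
  · have h1 := hst (RingEquiv.refl ℂ)
    have hcomp : ∀ u : K₀ →+* ℂ, ((RingEquiv.refl ℂ : ℂ ≃+* ℂ) : ℂ →+* ℂ).comp u = u := fun u =>
      RingHom.ext fun _ => rfl
    rw [hcomp, hcomp, ht] at h1
    exact iff_not_self (h1.symm.trans (Φ₀.2 s))

/-- **`ρ(ℂ^Φ/u(𝔪)) = (dim X)²` when `Φ` is induced from an IMAGINARY QUADRATIC subfield `K₀`** (`X ∼ E^g` for the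
CM curve `E = ℂ/u(𝔪₀)`, THM 3; «`ρ(E^k) = k²` (`E` has CM)»): `[K : K₀] = dim X`. [cite: HulekLaface2019PicardNumbers, Cor. 2.6]
[cite: Lange2023AbelianVarietiesComplex, §2.6.3 Exercise (2) (ii) ⟹ (i)] [cite: Murty1984, Lemma 3.3] -/
theorem finrank_neronSeveriGroup_eq_sq_of_inducedCMType_quadratic {K₀ : IntermediateField ℚ K}
    (hK₀ : finrank ℚ K₀ = 2) {Φ₀ : CMType K₀} (hΦ : inducedCMType (algebraMap K₀ K) Φ₀ = Φ) :
    finrank ℤ (ComplexTorus.neronSeveriGroup (periodEquiv Φ μ)) = (finrank ℚ K / 2) ^ 2 := by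
  haveI := isCMField_of_cmType_intermediateField K₀ Φ₀
  rw [finrank_neronSeveriGroup_eq_of_inducedCMType Φ μ hΦ (primitive_of_finrank_eq_two hK₀ Φ₀), sq]
  congr 1
  have h := Module.finrank_mul_finrank ℚ K₀ K
  rw [hK₀] at h
  omega

/-- **`ρ(X) = (dim X)² ⟺ Φ` is induced from an imaginary quadratic subfield** — Lange 2023 §2.6.3 Exercise (2)
«(i) `ρ(X) = g²` ⟺ (ii) `X` is isogenous to `E^g` with an elliptic curve `E` with complex multiplication» read on
the CM torus `X = ℂ^Φ/u(𝔪)` of a CM field: `⟹` because `ρ = [K : K₁] · g` for the primitive sub-pair forces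
`[K : K₁] = g`, i.e. `[K₁ : ℚ] = 2`. [cite: Lange2023AbelianVarietiesComplex, §2.6.3 Exercise (2) (i) ⟺ (ii)]
[cite: HulekLaface2019PicardNumbers, Cor. 2.6] [cite: Murty1984, Lemma 3.3] -/
theorem finrank_neronSeveriGroup_eq_sq_iff_exists_quadratic :
    finrank ℤ (ComplexTorus.neronSeveriGroup (periodEquiv Φ μ)) = (finrank ℚ K / 2) ^ 2 ↔
      ∃ (K₀ : IntermediateField ℚ K) (Φ₀ : CMType K₀), finrank ℚ K₀ = 2 ∧
        inducedCMType (algebraMap K₀ K) Φ₀ = Φ := by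
  refine ⟨fun h => ?_, fun ⟨K₀, Φ₀, hK₀, hΦ⟩ => finrank_neronSeveriGroup_eq_sq_of_inducedCMType_quadratic Φ μ hK₀ hΦ⟩
  obtain ⟨K₁, Φ₁, hΦ, -, hρ⟩ := exists_primitive_finrank_neronSeveriGroup_eq Φ μ
  refine ⟨K₁, Φ₁, ?_, hΦ⟩
  rw [h, sq] at hρ
  have hh : finrank K₁ K = finrank ℚ K / 2 := (Nat.eq_of_mul_eq_mul_right (div_two_pos Φ) hρ).symm
  have htower := Module.finrank_mul_finrank ℚ K₁ K
  have h2 := HodgeStructure.two_mul_ncard_cmType_eq_finrank Φ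
  rw [hh] at htower
  have hg : 0 < finrank ℚ K / 2 := div_two_pos Φ
  have : finrank ℚ K₁ * (finrank ℚ K / 2) = 2 * (finrank ℚ K / 2) := by omega
  exact Nat.eq_of_mul_eq_mul_right hg this

omit [IsCMField K] in
/-- `dim_ℂ ℂ^Φ = #Φ = [K : ℚ]/2` (`= dim X`). [cite: Shimura1998, §5.2] -/
theorem finrank_cmSpace_eq_div_two : finrank ℂ (Φ.1 → ℂ) = finrank ℚ K / 2 := by
  have h2 := HodgeStructure.two_mul_ncard_cmType_eq_finrank Φ
  have hc : Fintype.card Φ.1 = Φ.1.ncard := by rw [Set.ncard_eq_toFinset_card', Set.toFinset_card]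
  rw [Module.finrank_fintype_fun_eq_card]
  omega

/-- **`Dᵖ(X) = H^{2p}_Hodge(X)` for the CM torus of a type induced from an imaginary quadratic subfield**: every
Hodge class on `X = ℂ^Φ/u(𝔪) ∼ E^g` is a polynomial in divisor classes (`ρ = g²` and Lange 2023 §7.3.3 Exercise
(3)(a), tree `ComplexTorus.divisorClasses_eq_hodgeClasses_of_finrank_neronSeveriGroup_eq_sq`) — a KNOWN case (Tate,
Murasaki, van Geemen Thm. 4.3). [cite: Lange2023AbelianVarietiesComplex, §7.3.3 Exercise (3)(a)]
[cite: Lange2023AbelianVarietiesComplex, §2.6.3 Exercise (2)] -/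
theorem divisorClasses_eq_hodgeClasses_of_inducedCMType_quadratic {K₀ : IntermediateField ℚ K}
    (hK₀ : finrank ℚ K₀ = 2) {Φ₀ : CMType K₀} (hΦ : inducedCMType (algebraMap K₀ K) Φ₀ = Φ) (p : ℕ) :
    ComplexTorus.divisorClasses (periodEquiv Φ μ) p = ComplexTorus.hodgeClasses (periodEquiv Φ μ) p :=
  ComplexTorus.divisorClasses_eq_hodgeClasses_of_finrank_neronSeveriGroup_eq_sq (periodEquiv Φ μ)
    (by rw [finrank_neronSeveriGroup_eq_sq_of_inducedCMType_quadratic Φ μ hK₀ hΦ, finrank_cmSpace_eq_div_two]) p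

/-- … and **`dim_ℚ H^{2p}_Hodge(X) = C(g,p)²`** (Lange 2023 §7.3.3 Exercise (3)(b); `p = 1`: «`ρ(E^k) = k²`»).
[cite: Lange2023AbelianVarietiesComplex, §7.3.3 Exercise (3)(b)] [cite: HulekLaface2019PicardNumbers, Cor. 2.6] -/
theorem finrank_hodgeClasses_eq_choose_sq_of_inducedCMType_quadratic {K₀ : IntermediateField ℚ K}
    (hK₀ : finrank ℚ K₀ = 2) {Φ₀ : CMType K₀} (hΦ : inducedCMType (algebraMap K₀ K) Φ₀ = Φ) (p : ℕ) :
    finrank ℚ (ComplexTorus.hodgeClasses (periodEquiv Φ μ) p) = ((finrank ℚ K / 2).choose p) ^ 2 := by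
  rw [ComplexTorus.finrank_hodgeClasses_eq_choose_sq_of_finrank_neronSeveriGroup_eq_sq (periodEquiv Φ μ)
    (by rw [finrank_neronSeveriGroup_eq_sq_of_inducedCMType_quadratic Φ μ hK₀ hΦ, finrank_cmSpace_eq_div_two]) p,
    finrank_cmSpace_eq_div_two]

end CMField

end CMTorus

end Literature.AlgebraicGeometry.ComplexMultiplication

end
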